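import Summits.Ventures.HSemireg.WedgeHankelClassSpaceRaisingShearFlagsPow

/-!
# Venture HSemireg — SAME JORDAN TYPE, DIFFERENT FLAGS: THE IMAGES SEPARATE FIRST — in characteristic `p`, for `λ ≠ 0` and `1 ≤ j ≤ p − 1`,
# **`range e^j = range (S_λ − 1)^j` if and only if `n ≤ p + j − 2`** (a threshold that MOVES with `j`, against the kernels' fixed threshold `n ≤ 2p − 2` of N1):
# `range e^j` is spanned by the spikes `E_a` with `a mod p ≥ j`, and for `n ≥ p + j − 1` the vector `(S_λ − 1)^j E_0` has the coordinate `j!·λ^{p+j−1} ≠ 0` at `E_{p+j−1}` (`(p+j−1) mod p = j − 1`)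

HONEST FRAMING. Part of the Lean index of the computation cell `pub-hsemireg` (seat p10 gen 25, Sunday typer «UNIFORM-IN-n»).
Finite-dimensional linear algebra of endomorphisms of th-7's class space + forward differences / Lucas (one step) / Fermat on the prime field ONLY: no variety, no cohomology theory, no
sheaf, no Ext group, no semiregularity map; nothing here says that HC / HC_CM / HC_AV holds; no Literature fact is declared or used.  Custodian versions as in `WedgeHankelSiegelIdeal`
(1/3) and `WedgeHankelFrameChange`; the dictionary (`e` the infinitesimal shear, `S_λ = SbC(1 λ 0 1)` the shear on `Sym^n`) is QUOTED, never asserted.  The threshold was first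
COMPUTED (ranks over `GF(p)`, `p ≤ 7`, all `j`, `n < 4p`; script `HOME/p10/flags-ej-vs-shear-p10g25.py.txt` / `ranges.py` in the seat folder), then proved.

WHAT IS IN THE TREE.  N1 (`WedgeHankelClassSpaceRaisingShearFlagsPow`): the master formula `repr_shear_sub_one_pow_spikeBasis` (`repr ((S_λ − 1)^j E_i) a = C(a,i) λ^{a−i} Δ^j(r^{a−i})(0)`),
`fwdDiff_iter_pow_apply_zero_of_lt` / `_self_apply_zero` / `_charP` (degree, `j!`, Fermat reduction), `choose_cast_eq_zero_of_lt_add_charP` (Lucas), and the kernel answer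
`ker e^j = ker (S_λ − 1)^j ↔ j = 0 ∨ p ≤ j ∨ n ≤ 2p − 2`; K28 `repr_pow_raising_spikeBasis`; K35 `mem_span_range_restrict_iff`, `finrank_span_range_restrict`,
`finrank_range_pow_shear_char_eq_card` (`dim range (S_λ − 1)^k = #{m : k ≤ m mod p}`); L6 `ascFactorial_succ_cast_eq_zero_iff_charP`.
THIS FILE (namespace `Summit.Ventures.HSemireg.Wedge.HankelFrameChange` continued; CHAINED on N1; K27's hypotheses `hE hEtop` for `e`):
* §443 THE IMAGE FLAG OF `e`: `ascFactorial_cast_ne_zero_iff_le_mod_charP` (`(a−j+1)⋯a ≠ 0 in K ↔ j ≤ a mod p`, `j ≤ a`), **`range_pow_raising_eq_span_charP`**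
  (`range e^j = span{E_a : j ≤ a mod p}`, characteristic `p`; every `n`, `j`), `finrank_range_pow_raising_eq_finrank_range_pow_shear_charP` (SAME JORDAN TYPE, image side).
* §444 THE IMAGE FLAG OF THE SHEAR: **`shear_sub_one_pow_spikeBasis_mem_span_of_le`** (`n ≤ p + j − 2 ⇒ (S_λ − 1)^j E_i ∈ span{E_a : j ≤ a mod p}`: degree, Lucas, Fermat),
  `range_shear_sub_one_pow_le_range_pow_raising_of_le`, **`range_pow_raising_eq_range_shear_sub_one_pow_of_le`** (`n ≤ p + j − 2 ⇒` equal images; every `j`),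
  `repr_shear_sub_one_pow_spikeBasis_zero` (the `E_{p+j−1}`-coordinate of `(S_λ − 1)^j E_0` is `λ^{p+j−1} · j!`), `shear_sub_one_pow_spikeBasis_zero_notMem_range_pow_raising`
  (`n ≥ p + j − 1`, `1 ≤ j < p`), `not_range_shear_sub_one_pow_le_range_pow_raising`, `not_range_pow_raising_le_range_shear_sub_one_pow`, **`range_pow_raising_eq_range_shear_sub_one_pow_iff`**
  (`1 ≤ j < p`: `range e^j = range (S_λ − 1)^j ↔ n ≤ p + j − 2`), `range_pow_raising_eq_bot_of_prime_le` / `range_shear_sub_one_pow_eq_bot_of_prime_le`, and the complete answer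
  **`range_pow_raising_eq_range_shear_sub_one_pow_iff'`: `range e^j = range (S_λ − 1)^j ↔ j = 0 ∨ p ≤ j ∨ n ≤ p + j − 2`**.
READING: with N1 — the two operators have one Jordan type; their KERNEL flags agree below `n = 2p − 1` for every `j`, but their IMAGE flags agree only below `n = p + j − 1`: for
`p + j − 1 ≤ n ≤ 2p − 2` (`j ≤ p − 2`) the kernels of `e^j` and `(S_λ − 1)^j` coincide while the images differ.  Nothing Ext-side.  New names only.
-/

open Module fwdDiff

namespace Summit.Ventures.HSemireg.Wedge.HankelFrameChange

open Summit.Ventures.HSemireg.Wedge Summit.Ventures.HSemireg.Wedge.Kunneth Summit.Ventures.HSemireg.Wedge.Hankel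
  Summit.Ventures.HSemireg.Wedge.BasisFree Summit.Ventures.HSemireg.Wedge.HankelSiegel Summit.Ventures.HSemireg.Wedge.HankelSiegelIdeal
  Summit.Ventures.HSemireg.Wedge.KunnethKernel Summit.Ventures.HSemireg.Wedge.HankelRankOne Summit.Ventures.HSemireg.Wedge.KernelDuality

variable (K : Type*) [Field K] {n : ℕ}

/-! ## §443. The image flag of the raising operator in characteristic `p` -/

/-- `(a−j+1)(a−j+2)⋯a ≠ 0` in characteristic `p` iff `j ≤ a mod p` (for `j ≤ a`: the window `(a−j, a]` contains no multiple of `p`). -/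
theorem ascFactorial_cast_ne_zero_iff_le_mod_charP (p : ℕ) [Fact p.Prime] [CharP K p] {a j : ℕ} (hja : j ≤ a) :
    (((a - j + 1).ascFactorial j : ℕ) : K) ≠ 0 ↔ j ≤ a % p := by
  have hp := (Fact.out : p.Prime).one_lt
  rw [Ne, ascFactorial_succ_cast_eq_zero_iff_charP K p (a - j) j, not_le]
  have e : a = (a - j) + j := by omega
  constructor
  · intro h
    have : a % p = (a - j) % p + j := by
      conv_lhs => rw [e]
      rw [Nat.add_mod, Nat.mod_eq_of_lt (show j < p by have := Nat.mod_lt (a - j) (by omega : 0 < p); omega),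
        Nat.mod_eq_of_lt h]
    omega
  · intro h
    have hmod : (a - j) % p = a % p - j := by
      have h2 : a - j = p * (a / p) + (a % p - j) := by have := Nat.div_add_mod a p; omega
      rw [h2, Nat.mul_add_mod, Nat.mod_eq_of_lt (by have := Nat.mod_lt a (by omega : 0 < p); omega)]
    have := Nat.mod_lt a (show 0 < p by omega)
    omega

section RaisingImages

variable {e : Module.End K (spikeSpan K n)}
  (hE : ∀ (i : Fin (n + 1)) (hi : (i : ℕ) < n), e (spikeBasis K n i) = (((i : ℕ) : K) + 1) • spikeBasis K n ⟨(i : ℕ) + 1, by omega⟩) (hEtop : e (spikeBasis K n (Fin.last n)) = 0)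
include hE hEtop

/-- **THE IMAGE FLAG OF `e` IN CHARACTERISTIC `p`: `range e^j = span{E_a : j ≤ a mod p}`** (every `n`, every `j`): `e^j E_i = (i+1)⋯(i+j) E_{i+j}`, and the coefficient is a unit
exactly when `j ≤ (i+j) mod p`. -/
theorem range_pow_raising_eq_span_charP (p : ℕ) [Fact p.Prime] [CharP K p] (j : ℕ) :
    LinearMap.range (e ^ j) = Submodule.span K (Set.range fun a : {a : Fin (n + 1) // j ≤ (a : ℕ) % p} => spikeBasis K n a) := by
  have hp := (Fact.out : p.Prime).one_lt
  refine le_antisymm ?_ ?_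
  · rw [LinearMap.range_eq_map, ← (spikeBasis K n).span_eq, Submodule.map_span, Submodule.span_le]
    rintro _ ⟨_, ⟨i, rfl⟩, rfl⟩
    rw [SetLike.mem_coe, mem_span_range_restrict_iff]
    intro a ha
    rw [repr_pow_raising_spikeBasis K hE hEtop]
    by_cases h : (a : ℕ) = (i : ℕ) + j
    · rw [if_pos h]
      by_contra hne
      have h2 := (ascFactorial_cast_ne_zero_iff_le_mod_charP K p (show j ≤ (a : ℕ) by omega)).mp (by rwa [show (a : ℕ) - j = (i : ℕ) by omega])
      exact ha h2
    · rw [if_neg h]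
  · rw [Submodule.span_le]
    rintro _ ⟨⟨a, ha⟩, rfl⟩
    have hja : j ≤ (a : ℕ) := le_trans ha (Nat.mod_le _ _)
    have hne := (ascFactorial_cast_ne_zero_iff_le_mod_charP K p hja).mpr ha
    have himg := pow_raising_spikeBasis_of_le K hE ⟨(a : ℕ) - j, by omega⟩ (k := j) (by have := a.2; simp only; omega)
    have ea : (⟨(((⟨(a : ℕ) - j, by omega⟩ : Fin (n + 1)) : ℕ)) + j, by simp only; omega⟩ : Fin (n + 1)) = a := Fin.ext (by simp only; omega)
    rw [ea] at himg
    rw [SetLike.mem_coe, LinearMap.mem_range]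
    refine ⟨((((a : ℕ) - j + 1).ascFactorial j : ℕ) : K)⁻¹ • spikeBasis K n ⟨(a : ℕ) - j, by omega⟩, ?_⟩
    rw [map_smul, himg, smul_smul, inv_mul_cancel₀ hne, one_smul]

/-- **SAME JORDAN TYPE, image side: `dim range e^j = dim range (S_λ − 1)^j`** in characteristic `p` (`λ ≠ 0`; rank–nullity on L6's kernel statement). -/
theorem finrank_range_pow_raising_eq_finrank_range_pow_shear_charP (p : ℕ) [Fact p.Prime] [CharP K p] {lam : K} (hlam : lam ≠ 0) (j : ℕ) :
    finrank K ↥(LinearMap.range (e ^ j)) = finrank K ↥(LinearMap.range ((SbC K 1 lam 0 1 (n := n) - 1) ^ j)) := by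
  have h1 := LinearMap.finrank_range_add_finrank_ker (e ^ j)
  have h2 := LinearMap.finrank_range_add_finrank_ker ((SbC K 1 lam 0 1 (n := n) - 1) ^ j)
  have h3 := finrank_ker_pow_raising_eq_finrank_ker_pow_shear_charP K hE hEtop p hlam j
  omega

/-! ## §444. The image flag of the shear: equal to that of `e` iff `n ≤ p + j − 2` -/

omit hE hEtop in
/-- **`n ≤ p + j − 2 ⇒ (S_λ − 1)^j E_i ∈ span{E_a : j ≤ a mod p}`** (characteristic `p`, every `λ`): a coordinate `C(a,i) λ^{a−i} Δ^j(r^{a−i})(0)` with `a mod p < j` vanishes — for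
`a < p` by degree (`a − i ≤ a < j`), and for `p ≤ a ≤ p + j − 2` by degree if `a − i < j`, by Lucas if `i < p ≤ a < i + p`, by Fermat if `a ≥ i + p` (`a − i − p + 1 ≤ j − 1 − i < j`). -/
theorem shear_sub_one_pow_spikeBasis_mem_span_of_le (p : ℕ) [Fact p.Prime] [CharP K p] (lam : K) {j : ℕ} (hn : n ≤ p + j - 2) (i : Fin (n + 1)) :
    ((SbC K 1 lam 0 1 - 1) ^ j) (spikeBasis K n i) ∈ Submodule.span K (Set.range fun a : {a : Fin (n + 1) // j ≤ (a : ℕ) % p} => spikeBasis K n a) := by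
  have hp := (Fact.out : p.Prime).one_lt
  rw [mem_span_range_restrict_iff]
  intro a ha
  rw [not_le] at ha
  have haN := a.2
  rw [repr_shear_sub_one_pow_spikeBasis]
  by_cases hia : (i : ℕ) ≤ a
  · rw [if_pos hia]
    by_cases hd : (a : ℕ) - (i : ℕ) < j
    · rw [fwdDiff_iter_pow_apply_zero_of_lt K hd, mul_zero]
    · -- `a − i ≥ j`, so `a ≥ j`; then `a ≥ p` (else `a mod p = a ≥ j`), `i < p`
      have hap : p ≤ (a : ℕ) := by
        by_contra hlt
        rw [Nat.mod_eq_of_lt (by omega)] at ha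
        omega
      have hi : (i : ℕ) < p := by omega
      by_cases hlt : (a : ℕ) < (i : ℕ) + p
      · rw [choose_cast_eq_zero_of_lt_add_charP K p hi hap hlt, zero_mul, zero_mul]
      · rw [fwdDiff_iter_pow_apply_zero_charP K p j (by omega : p ≤ (a : ℕ) - (i : ℕ)), fwdDiff_iter_pow_apply_zero_of_lt K (by omega), mul_zero]
  · rw [if_neg hia]

/-- `n ≤ p + j − 2 ⇒ range (S_λ − 1)^j ≤ range e^j` (characteristic `p`). -/
theorem range_shear_sub_one_pow_le_range_pow_raising_of_le (p : ℕ) [Fact p.Prime] [CharP K p] (lam : K) {j : ℕ} (hn : n ≤ p + j - 2) :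
    LinearMap.range ((SbC K 1 lam 0 1 - 1) ^ j) ≤ LinearMap.range (e ^ j) := by
  rw [range_pow_raising_eq_span_charP K hE hEtop p j, LinearMap.range_eq_map, ← (spikeBasis K n).span_eq, Submodule.map_span, Submodule.span_le]
  rintro _ ⟨_, ⟨i, rfl⟩, rfl⟩
  exact shear_sub_one_pow_spikeBasis_mem_span_of_le K p lam hn i

/-- **`n ≤ p + j − 2 ⇒ range e^j = range (S_λ − 1)^j`** (`λ ≠ 0`, characteristic `p`, every `j`): inclusion (above) and equal dimension. -/
theorem range_pow_raising_eq_range_shear_sub_one_pow_of_le (p : ℕ) [Fact p.Prime] [CharP K p] {lam : K} (hlam : lam ≠ 0) {j : ℕ} (hn : n ≤ p + j - 2) :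
    LinearMap.range (e ^ j) = LinearMap.range ((SbC K 1 lam 0 1 - 1) ^ j) :=
  (Submodule.eq_of_le_of_finrank_eq (range_shear_sub_one_pow_le_range_pow_raising_of_le K hE hEtop p lam hn)
    (finrank_range_pow_raising_eq_finrank_range_pow_shear_charP K hE hEtop p hlam j).symm).symm

omit hE hEtop in
/-- **the `E_{p+j−1}`-coordinate of `(S_λ − 1)^j E_0` is `λ^{p+j−1} · j!`** (`p + j − 1 ≤ n`, `1 ≤ j`): `C(p+j−1, 0) = 1` and Fermat reduces `Δ^j r^{p+j−1}` to `Δ^j r^j = j!`. -/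
theorem repr_shear_sub_one_pow_spikeBasis_zero (p : ℕ) [Fact p.Prime] [CharP K p] (lam : K) {j : ℕ} (hj1 : 1 ≤ j) {a : Fin (n + 1)} (ha : (a : ℕ) + 1 = p + j) :
    (spikeBasis K n).repr (((SbC K 1 lam 0 1 - 1) ^ j) (spikeBasis K n 0)) a = lam ^ (p + j - 1) * ((j.factorial : ℕ) : K) := by
  have hp := (Fact.out : p.Prime).one_lt
  rw [repr_shear_sub_one_pow_spikeBasis, Fin.val_zero, if_pos (Nat.zero_le _), Nat.sub_zero, Nat.choose_zero_right, Nat.cast_one, one_mul,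
    fwdDiff_iter_pow_apply_zero_charP K p j (by omega : p ≤ (a : ℕ)), show (a : ℕ) - (p - 1) = j by omega, fwdDiff_iter_pow_self_apply_zero,
    show (a : ℕ) = p + j - 1 by omega]

/-- **`n ≥ p + j − 1`, `1 ≤ j < p` ⇒ `(S_λ − 1)^j E_0 ∉ range e^j`** (`λ ≠ 0`): its `E_{p+j−1}`-coordinate is a unit while `(p + j − 1) mod p = j − 1 < j`. -/
theorem shear_sub_one_pow_spikeBasis_zero_notMem_range_pow_raising (p : ℕ) [Fact p.Prime] [CharP K p] {lam : K} (hlam : lam ≠ 0) {j : ℕ} (hj1 : 1 ≤ j) (hjp : j < p)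
    (hn : p + j - 1 ≤ n) : ((SbC K 1 lam 0 1 - 1) ^ j) (spikeBasis K n 0) ∉ LinearMap.range (e ^ j) := by
  have hp := (Fact.out : p.Prime).one_lt
  intro h
  rw [range_pow_raising_eq_span_charP K hE hEtop p j, mem_span_range_restrict_iff] at h
  have hmod : ¬ j ≤ (((⟨p + j - 1, by omega⟩ : Fin (n + 1)) : ℕ)) % p := by
    simp only
    rw [show p + j - 1 = p + (j - 1) by omega, Nat.add_mod_left, Nat.mod_eq_of_lt (by omega)]
    omega
  have h0 := h ⟨p + j - 1, by omega⟩ hmod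
  rw [repr_shear_sub_one_pow_spikeBasis_zero K p lam hj1 (by simp only; omega)] at h0
  exact mul_ne_zero (pow_ne_zero _ hlam) (factorial_cast_ne_zero_of_lt_char K p hjp) h0

/-- **`n ≥ p + j − 1`, `1 ≤ j < p` ⇒ `¬ range (S_λ − 1)^j ≤ range e^j`.** -/
theorem not_range_shear_sub_one_pow_le_range_pow_raising (p : ℕ) [Fact p.Prime] [CharP K p] {lam : K} (hlam : lam ≠ 0) {j : ℕ} (hj1 : 1 ≤ j) (hjp : j < p)
    (hn : p + j - 1 ≤ n) : ¬ LinearMap.range ((SbC K 1 lam 0 1 - 1) ^ j) ≤ LinearMap.range (e ^ j) :=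
  fun hle => shear_sub_one_pow_spikeBasis_zero_notMem_range_pow_raising K hE hEtop p hlam hj1 hjp hn (hle (LinearMap.mem_range_self _ _))

/-- **`n ≥ p + j − 1`, `1 ≤ j < p` ⇒ `¬ range e^j ≤ range (S_λ − 1)^j`** either (equal dimensions): neither image contains the other. -/
theorem not_range_pow_raising_le_range_shear_sub_one_pow (p : ℕ) [Fact p.Prime] [CharP K p] {lam : K} (hlam : lam ≠ 0) {j : ℕ} (hj1 : 1 ≤ j) (hjp : j < p)
    (hn : p + j - 1 ≤ n) : ¬ LinearMap.range (e ^ j) ≤ LinearMap.range ((SbC K 1 lam 0 1 - 1) ^ j) := by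
  intro hle
  have heq := Submodule.eq_of_le_of_finrank_eq hle (finrank_range_pow_raising_eq_finrank_range_pow_shear_charP K hE hEtop p hlam j)
  exact not_range_shear_sub_one_pow_le_range_pow_raising K hE hEtop p hlam hj1 hjp hn heq.symm.le

/-- **THE IMAGES SEPARATE FIRST: for `1 ≤ j < p`, `range e^j = range (S_λ − 1)^j ↔ n ≤ p + j − 2`** (`λ ≠ 0`, characteristic `p`) — a threshold moving with `j`, against the
kernels' `n ≤ 2p − 2` (N1). -/
theorem range_pow_raising_eq_range_shear_sub_one_pow_iff (p : ℕ) [Fact p.Prime] [CharP K p] {lam : K} (hlam : lam ≠ 0) {j : ℕ} (hj1 : 1 ≤ j) (hjp : j < p) :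
    LinearMap.range (e ^ j) = LinearMap.range ((SbC K 1 lam 0 1 - 1) ^ j) ↔ n ≤ p + j - 2 :=
  ⟨fun h => by
    by_contra hn
    exact not_range_pow_raising_le_range_shear_sub_one_pow K hE hEtop p hlam hj1 hjp (by omega) h.le,
   fun hn => range_pow_raising_eq_range_shear_sub_one_pow_of_le K hE hEtop p hlam hn⟩

/-- `p ≤ j ⇒ range e^j = ⊥` (`e^j = 0`, K43). -/
theorem range_pow_raising_eq_bot_of_prime_le (p : ℕ) [Fact p.Prime] [CharP K p] {j : ℕ} (hpj : p ≤ j) : LinearMap.range (e ^ j) = ⊥ := by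
  rw [(raising_pow_eq_zero_iff_charP K hE hEtop p j).mpr (le_trans (min_le_left _ _) hpj), LinearMap.range_zero]

omit hE hEtop in
/-- `p ≤ j ⇒ range (S_λ − 1)^j = ⊥` (`λ ≠ 0`). -/
theorem range_shear_sub_one_pow_eq_bot_of_prime_le (p : ℕ) [Fact p.Prime] [CharP K p] {lam : K} (hlam : lam ≠ 0) {j : ℕ} (hpj : p ≤ j) :
    LinearMap.range ((SbC K 1 lam 0 1 (n := n) - 1) ^ j) = ⊥ := by
  rw [(SbC_shear_sub_one_pow_eq_zero_iff_char K hlam p j).mpr (le_trans (min_le_left _ _) hpj), LinearMap.range_zero]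

/-- **THE COMPLETE ANSWER, IMAGE SIDE: `range e^j = range (S_λ − 1)^j ↔ j = 0 ∨ p ≤ j ∨ n ≤ p + j − 2`** (`λ ≠ 0`, characteristic `p`, every `n`, every `j`). -/
theorem range_pow_raising_eq_range_shear_sub_one_pow_iff' (p : ℕ) [Fact p.Prime] [CharP K p] {lam : K} (hlam : lam ≠ 0) (j : ℕ) :
    LinearMap.range (e ^ j) = LinearMap.range ((SbC K 1 lam 0 1 - 1) ^ j) ↔ j = 0 ∨ p ≤ j ∨ n ≤ p + j - 2 := by
  constructor
  · intro h
    by_contra hc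
    simp only [not_or, not_le] at hc
    exact not_range_pow_raising_le_range_shear_sub_one_pow K hE hEtop p hlam (by omega) hc.2.1 (by omega) h.le
  · rintro (rfl | hpj | hn)
    · rw [pow_zero, pow_zero]
    · rw [range_pow_raising_eq_bot_of_prime_le K hE hEtop p hpj, range_shear_sub_one_pow_eq_bot_of_prime_le K p hlam hpj]
    · exact range_pow_raising_eq_range_shear_sub_one_pow_of_le K hE hEtop p hlam hn

end RaisingImages

end Summit.Ventures.HSemireg.Wedge.HankelFrameChange
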